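import Literature.Analysis.FluidPDE.AncientSimilarityVorticity
import Literature.Analysis.FluidPDE.NewtonKernel

/-!
# Route `FilamentSkeletonRss` · crux `SelectionBoxRJ` (stmt-NavierStokesRegularity-21220) — the VORTICITY FORM of the
# rotating-Leray profile operator: `curl E_α(U) = 𝓣_α(curl U)`, i.e. the curl commutes with the rotation generator and
# turns `E_α` into the transport–stretching operator of the torque budget

Lane `ns-filament-19175-p1` (g10).  Helper file `--supports stmt-NavierStokesRegularity-21220 --as helper`; route-independent
(operator written out verbatim, `= KelvinGate.lerayOp` by `rfl`).  Bears on the J selection layer (21220 / 21221 / 19174–19175).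

SOURCE OF THE STATEMENT.  F6 verdict memo of the crux-level line `rpi_window_split`
(`Cruxes/SelectionBoxRJ/Lines/rpi_window_split_v6_F6.md`, ns-idea-12 g2, 2026-08-28), §1(a), labelled EXACT:
«`curl(profileOp_α U) = −ΔW + curl(W × A)`, `A := U + ½y − α e₃×y`, `W := curl U`.  [div U = 0;
`curl(½U+½(y·∇)U) = W + ½(y·∇)W`; the α-bracket is the rotation generator `G`, `curl∘G = G∘curl`;
`curl((U·∇)U) = (U·∇)W − (W·∇)U`; …]» — the identity behind the torque budget (TB) on flat discs (§1(b)).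

WHAT IS KERNEL-CHECKED HERE (pointwise, `E_α(U)(y) = α•(e₃ × U y − DU(y)[e₃ × y]) + ½•U y + ½•DU(y)[y] − ΔU(y) + DU(y)[U y]`):
* `curlCLM_comm_crossCLM` — the matrix identity behind `curl∘G = G∘curl`:
  `curlCLM((e×·)∘M) − curlCLM(M∘(e×·)) = e × curlCLM M` for every linear `M` and vector `e`;
* `curl_cross_const_left` — `curl (e × U) = curlCLM((e×·)∘DU)`; `curl_fderiv_apply_cross` —
  `curl (y ↦ DU(y)[e × y]) = curlCLM(DU(x)∘(e×·)) + D(curl U)(x)[e × x]` (`U ∈ C²`, Schwarz);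
* `curl_rotationGenerator` — **`curl∘G_e = G_e∘curl`**: `curl (e × U − DU[e × y]) = e × W − DW[e × y]`, `W = curl U`, `U ∈ C²`;
* `curl_lerayTransport` — `curl (½U + ½DU[y]) = W + ½DW[y]` (tree `curl_fderiv_apply_self`);
* `curl_profileOp` — **memo §1(a)**: for `U ∈ C³(ℝ³; ℝ³)` divergence-free,
  `curl E_α(U)(x) = α•(e₃ × W − DW[e₃ × x]) + W + ½DW[x] − ΔW + DW[U] − DU[W]` at every `x`
  (tree `curl_laplacian`, `curl_convect_self_of_isDivFree`), the transport–stretching operator of the similarity-frame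
  vorticity equation applied to `W = curl U`, plus the rotation generator acting on `W`.
* `trace_crossCLM`, `hasFDerivAt_transportField`, `divergence_transportField` (`div A = div U + 3/2`),
  `curl_cross_transportField`, and **`curl_profileOp_eq_transport` — memo §1(a) as printed: `curl E_α(U) = −ΔW + curl(W × A)`**.
NOT here: the Stokes/disc integration (TB) itself (tree `circulation_circleLoop_eq_integral_curl` is the tool).

HONEST FRAMING.  Exact vector calculus about the profile operator of a HYPOTHETICAL filament-type rotating Leray profile
(refutation-side bookkeeping); nothing here bears on Navier–Stokes regularity or blow-up; no summit statement is proved.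
-/

set_option linter.dupNamespace false

noncomputable section

namespace Summit.NavierStokesRegularity.NavierStokesRegularity.Theorems

open Set Function Filter Real
open Literature.Analysis.FluidPDE
open scoped InnerProductSpace Topology
open Laplacian

namespace TorqueBudget

/-! ### The matrix identity behind `curl ∘ G = G ∘ curl` -/

/-- Expansion of a linear map of `ℝ³` along the standard frame: `M v = Σ_j v_j • M e_j`. [folklore] -/
theorem clm_apply_eq_sum_smul (M : EuclideanSpace ℝ (Fin 3) →L[ℝ] EuclideanSpace ℝ (Fin 3))
    (v : EuclideanSpace ℝ (Fin 3)) : M v = ∑ j, v j • M (EuclideanSpace.single j 1) := by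
  conv_lhs => rw [show v = ∑ j, v j • EuclideanSpace.single j (1:ℝ) by
    simpa using ((EuclideanSpace.basisFun (Fin 3) ℝ).sum_repr v).symm]
  simp [map_sum, map_smul]

/-- **`curlCLM((e×·)∘M) − curlCLM(M∘(e×·)) = e × curlCLM M`** for every linear map `M` of `ℝ³` and every vector `e`:
with `M = DU(x)` the two terms are the Jacobian parts of `curl (e × U)` and of `curl (DU[e × y])`, and the right side is
`e × curl U` — the algebra of `curl∘G_e = G_e∘curl` for the rotation generator `G_e U = e × U − DU[e × y]`. [folklore] -/
theorem curlCLM_comm_crossCLM (M : EuclideanSpace ℝ (Fin 3) →L[ℝ] EuclideanSpace ℝ (Fin 3))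
    (e : EuclideanSpace ℝ (Fin 3)) :
    curlCLM ((crossCLM e).comp M) - curlCLM (M.comp (crossCLM e)) = cross e (curlCLM M) := by
  rw [curlCLM_crossCLM_comp, clm_apply_eq_sum_smul M e]
  have h0 := clm_apply_eq_sum_smul M (cross e (EuclideanSpace.single 0 1))
  have h1 := clm_apply_eq_sum_smul M (cross e (EuclideanSpace.single 1 1))
  have h2 := clm_apply_eq_sum_smul M (cross e (EuclideanSpace.single 2 1))
  simp only [curlCLM_apply, ContinuousLinearMap.comp_apply, crossCLM_apply]
  rw [h0, h1, h2]
  ext k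
  fin_cases k <;>
    simp [cross, cross_apply, Fin.sum_univ_three] <;> ring

/-! ### The two halves of the rotation generator -/

/-- `curl (e × U)(x) = curlCLM((e×·) ∘ DU(x))` at a point of differentiability (chain rule). [folklore] -/
theorem curl_cross_const_left {U : EuclideanSpace ℝ (Fin 3) → EuclideanSpace ℝ (Fin 3)} {x : EuclideanSpace ℝ (Fin 3)}
    (hU : DifferentiableAt ℝ U x) (e : EuclideanSpace ℝ (Fin 3)) :
    curl (fun y => cross e (U y)) x = curlCLM ((crossCLM e).comp (fderiv ℝ U x)) := by
  have h : HasFDerivAt (fun y => cross e (U y)) ((crossCLM e).comp (fderiv ℝ U x)) x :=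
    (crossCLM e).hasFDerivAt.comp x hU.hasFDerivAt
  rw [curl_eq_curlCLM, h.fderiv]

/-- `curl (y ↦ DU(y)[e × y])(x) = curlCLM(DU(x) ∘ (e×·)) + D(curl U)(x)[e × x]` for `U ∈ C²` (product rule; the second
derivative is symmetric, Schwarz, so the part falling on `DU` is `(e × x)·∇` of the curl). [folklore] -/
theorem curl_fderiv_apply_cross {U : EuclideanSpace ℝ (Fin 3) → EuclideanSpace ℝ (Fin 3)} (hU : ContDiff ℝ 2 U)
    (x e : EuclideanSpace ℝ (Fin 3)) :
    curl (fun y => fderiv ℝ U y (cross e y)) x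
      = curlCLM ((fderiv ℝ U x).comp (crossCLM e)) + fderiv ℝ (curl U) x (cross e x) := by
  have hD : HasFDerivAt (fderiv ℝ U) (fderiv ℝ (fderiv ℝ U) x) x :=
    (((hU.fderiv_right (m := 1) (by norm_num)).differentiable one_ne_zero).differentiableAt).hasFDerivAt
  have hg : HasFDerivAt (fun y => fderiv ℝ U y (cross e y))
      ((fderiv ℝ U x).comp (crossCLM e) + (fderiv ℝ (fderiv ℝ U) x).flip (cross e x)) x :=
    hD.clm_apply (crossCLM e).hasFDerivAt
  have hsymm : (fderiv ℝ (fderiv ℝ U) x).flip (cross e x) = fderiv ℝ (fderiv ℝ U) x (cross e x) := by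
    ext k i
    rw [ContinuousLinearMap.flip_apply]
    exact congrFun (congrArg _ ((hU.contDiffAt.isSymmSndFDerivAt (by simp)) k (cross e x))) i
  rw [curl_eq_curlCLM, hg.fderiv, map_add, hsymm, fderiv_curl hU x, ContinuousLinearMap.comp_apply]

/-- **`curl ∘ G_e = G_e ∘ curl`**: for `U ∈ C²(ℝ³; ℝ³)` and any `e`,
`curl (y ↦ e × U(y) − DU(y)[e × y])(x) = e × W(x) − DW(x)[e × x]`, `W = curl U` — the rotation generator of the
rotating Leray frame commutes with the curl (F6 memo §1(a)). [folklore] -/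
theorem curl_rotationGenerator {U : EuclideanSpace ℝ (Fin 3) → EuclideanSpace ℝ (Fin 3)} (hU : ContDiff ℝ 2 U)
    (x e : EuclideanSpace ℝ (Fin 3)) :
    curl (fun y => cross e (U y) - fderiv ℝ U y (cross e y)) x
      = cross e (curl U x) - fderiv ℝ (curl U) x (cross e x) := by
  have hUx : DifferentiableAt ℝ U x := (hU.differentiable two_ne_zero) x
  have h1 : DifferentiableAt ℝ (fun y => cross e (U y)) x :=
    ((crossCLM e).hasFDerivAt.comp x hUx.hasFDerivAt).differentiableAt
  have hD : DifferentiableAt ℝ (fderiv ℝ U) x :=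
    ((hU.fderiv_right (m := 1) (by norm_num)).differentiable one_ne_zero).differentiableAt
  have h2 : DifferentiableAt ℝ (fun y => fderiv ℝ U y (cross e y)) x :=
    (hD.hasFDerivAt.clm_apply (crossCLM e).hasFDerivAt).differentiableAt
  rw [curl_sub h1 h2, curl_cross_const_left hUx, curl_fderiv_apply_cross hU, ← sub_sub,
    curlCLM_comm_crossCLM, ← curl_eq_curlCLM]

/-! ### The Leray transport term and the full profile operator -/

/-- `curl (½U + ½DU[y])(x) = W(x) + ½DW(x)[x]`, `W = curl U`, for `U ∈ C²` (the Leray dilation–transport term; tree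
`curl_fderiv_apply_self`). [folklore] -/
theorem curl_lerayTransport {U : EuclideanSpace ℝ (Fin 3) → EuclideanSpace ℝ (Fin 3)} (hU : ContDiff ℝ 2 U)
    (x : EuclideanSpace ℝ (Fin 3)) :
    curl (fun y => (1 / 2 : ℝ) • U y + (1 / 2 : ℝ) • fderiv ℝ U y y) x
      = curl U x + (1 / 2 : ℝ) • fderiv ℝ (curl U) x x := by
  have hUx : DifferentiableAt ℝ U x := (hU.differentiable two_ne_zero) x
  have hD : DifferentiableAt ℝ (fderiv ℝ U) x :=
    ((hU.fderiv_right (m := 1) (by norm_num)).differentiable one_ne_zero).differentiableAt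
  have h2 : DifferentiableAt ℝ (fun y => fderiv ℝ U y y) x :=
    (hD.hasFDerivAt.clm_apply (hasFDerivAt_id x)).differentiableAt
  rw [curl_add (hUx.fun_const_smul (1 / 2 : ℝ)) (h2.fun_const_smul (1 / 2 : ℝ)), curl_const_smul hUx,
    curl_const_smul h2, curl_fderiv_apply_self hU x, smul_add, ← add_assoc, ← add_smul]
  norm_num

/-- **`curl E_α(U)` — the vorticity form of the profile operator** (F6 memo §1(a)).  For `U ∈ C³(ℝ³; ℝ³)` divergence-free
and `W = curl U`:
`curl E_α(U)(x) = α•(e₃ × W(x) − DW(x)[e₃ × x]) + W(x) + ½DW(x)[x] − ΔW(x) + DW(x)[U(x)] − DU(x)[W(x)]`,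
the rotation generator, Leray transport, dissipation, advection and stretching of `W` — equivalently
`−ΔW + curl(W × A)`, `A = U + ½y − αe₃×y` (not packaged here). [folklore] -/
theorem curl_profileOp (α : ℝ) {U : EuclideanSpace ℝ (Fin 3) → EuclideanSpace ℝ (Fin 3)} (hU : ContDiff ℝ 3 U)
    (hdiv : VectorCalculus.IsDivFree U) (x : EuclideanSpace ℝ (Fin 3)) :
    curl (fun y => α • (cross (EuclideanSpace.single 2 1) (U y) - fderiv ℝ U y (cross (EuclideanSpace.single 2 1) y))
        + (1 / 2 : ℝ) • U y + (1 / 2 : ℝ) • fderiv ℝ U y y - (Δ U) y + fderiv ℝ U y (U y)) x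
      = α • (cross (EuclideanSpace.single 2 1) (curl U x) - fderiv ℝ (curl U) x (cross (EuclideanSpace.single 2 1) x))
        + curl U x + (1 / 2 : ℝ) • fderiv ℝ (curl U) x x - (Δ (curl U)) x
        + (fderiv ℝ (curl U) x (U x) - fderiv ℝ U x (curl U x)) := by
  set e : EuclideanSpace ℝ (Fin 3) := EuclideanSpace.single 2 1 with he
  have hU2 : ContDiff ℝ 2 U := hU.of_le (by norm_num)
  have hUx : DifferentiableAt ℝ U x := (hU.differentiable (by norm_num)) x
  have hD : DifferentiableAt ℝ (fderiv ℝ U) x :=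
    ((hU.fderiv_right (m := 1) (by norm_num)).differentiable one_ne_zero).differentiableAt
  -- differentiability of the five summands at `x`
  have hG : DifferentiableAt ℝ (fun y => cross e (U y) - fderiv ℝ U y (cross e y)) x :=
    ((crossCLM e).hasFDerivAt.comp x hUx.hasFDerivAt).differentiableAt.fun_sub
      (hD.hasFDerivAt.clm_apply (crossCLM e).hasFDerivAt).differentiableAt
  have hyy : DifferentiableAt ℝ (fun y => fderiv ℝ U y y) x :=
    (hD.hasFDerivAt.clm_apply (hasFDerivAt_id x)).differentiableAt
  have hT : DifferentiableAt ℝ (fun y => (1 / 2 : ℝ) • U y + (1 / 2 : ℝ) • fderiv ℝ U y y) x :=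
    (hUx.fun_const_smul (1 / 2 : ℝ)).fun_add (hyy.fun_const_smul (1 / 2 : ℝ))
  have hL : DifferentiableAt ℝ (Δ U) x := ((contDiff_laplacian (n := 1) (hU.of_le (by norm_num))).differentiable
    one_ne_zero) x
  have hC : DifferentiableAt ℝ (fun y => fderiv ℝ U y (U y)) x := (hD.hasFDerivAt.clm_apply hUx.hasFDerivAt).differentiableAt
  -- split the curl along the sum
  have hsplit : curl (fun y => α • (cross e (U y) - fderiv ℝ U y (cross e y))
        + (1 / 2 : ℝ) • U y + (1 / 2 : ℝ) • fderiv ℝ U y y - (Δ U) y + fderiv ℝ U y (U y)) x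
      = α • curl (fun y => cross e (U y) - fderiv ℝ U y (cross e y)) x
        + curl (fun y => (1 / 2 : ℝ) • U y + (1 / 2 : ℝ) • fderiv ℝ U y y) x - curl (Δ U) x
        + curl (fun y => fderiv ℝ U y (U y)) x := by
    have e1 : (fun y => α • (cross e (U y) - fderiv ℝ U y (cross e y))
        + (1 / 2 : ℝ) • U y + (1 / 2 : ℝ) • fderiv ℝ U y y - (Δ U) y + fderiv ℝ U y (U y))
        = fun y => ((α • (cross e (U y) - fderiv ℝ U y (cross e y))
          + ((1 / 2 : ℝ) • U y + (1 / 2 : ℝ) • fderiv ℝ U y y)) - (Δ U) y) + fderiv ℝ U y (U y) := by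
      funext y; abel
    rw [e1, curl_add (((hG.fun_const_smul α).fun_add hT).fun_sub hL) hC,
      curl_sub ((hG.fun_const_smul α).fun_add hT) hL, curl_add (hG.fun_const_smul α) hT, curl_const_smul hG]
  have hconv : curl (fun y => fderiv ℝ U y (U y)) x = fderiv ℝ (curl U) x (U x) - fderiv ℝ U x (curl U x) := by
    have h := curl_convect_self_of_isDivFree hU2 hdiv x
    simp only [convect] at h
    exact h
  rw [hsplit, curl_rotationGenerator hU2 x e, curl_lerayTransport hU2 x, curl_laplacian hU x, hconv]
  abel

/-! ### Packaging: `curl E_α(U) = −ΔW + curl(W × A)`, `A = U + ½y − α e₃×y` -/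

/-- The rotation field `y ↦ e × y` is traceless: `tr (e×·) = 0`. [folklore] -/
theorem trace_crossCLM (e : EuclideanSpace ℝ (Fin 3)) :
    LinearMap.trace ℝ (EuclideanSpace ℝ (Fin 3)) (crossCLM e : EuclideanSpace ℝ (Fin 3) →ₗ[ℝ] EuclideanSpace ℝ (Fin 3)) = 0 := by
  rw [trace_eq_sum_coord]
  simp [crossCLM_apply, cross, cross_apply, Fin.sum_univ_three]

/-- The derivative of the transport field `A(y) = U(y) + ½y − α e×y`: `DA(x) = DU(x) + ½ id − α (e×·)`. [folklore] -/
theorem hasFDerivAt_transportField {U : EuclideanSpace ℝ (Fin 3) → EuclideanSpace ℝ (Fin 3)}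
    {x : EuclideanSpace ℝ (Fin 3)} (hU : DifferentiableAt ℝ U x) (α : ℝ) (e : EuclideanSpace ℝ (Fin 3)) :
    HasFDerivAt (fun y => U y + (1 / 2 : ℝ) • y - α • cross e y)
      (fderiv ℝ U x + (1 / 2 : ℝ) • ContinuousLinearMap.id ℝ (EuclideanSpace ℝ (Fin 3)) - α • crossCLM e) x :=
  (hU.hasFDerivAt.fun_add (hasFDerivAt_half_smul_id x)).fun_sub ((crossCLM e).hasFDerivAt.fun_const_smul α)

/-- The transport field has divergence `div U + 3/2` (in dimension three; the rotation part is traceless). [folklore] -/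
theorem divergence_transportField {U : EuclideanSpace ℝ (Fin 3) → EuclideanSpace ℝ (Fin 3)}
    {x : EuclideanSpace ℝ (Fin 3)} (hU : DifferentiableAt ℝ U x) (α : ℝ) (e : EuclideanSpace ℝ (Fin 3)) :
    VectorCalculus.divergence (fun y => U y + (1 / 2 : ℝ) • y - α • cross e y) x
      = VectorCalculus.divergence U x + 3 / 2 := by
  rw [VectorCalculus.divergence, (hasFDerivAt_transportField hU α e).fderiv]
  rw [ContinuousLinearMap.toLinearMap_sub, ContinuousLinearMap.toLinearMap_add, map_sub, map_add,
    ContinuousLinearMap.toLinearMap_smul, ContinuousLinearMap.toLinearMap_smul, map_smul, map_smul, trace_crossCLM,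
    smul_zero, sub_zero,
    show ((ContinuousLinearMap.id ℝ (EuclideanSpace ℝ (Fin 3)) : EuclideanSpace ℝ (Fin 3) →L[ℝ] EuclideanSpace ℝ (Fin 3))
        : EuclideanSpace ℝ (Fin 3) →ₗ[ℝ] EuclideanSpace ℝ (Fin 3)) = LinearMap.id from rfl,
    LinearMap.trace_id, finrank_euclideanSpace, Fintype.card_fin, VectorCalculus.divergence]
  norm_num

/-- **`curl (W × A)` for the transport field** `A = U + ½y − α e×y` at a point where `W`, `U` are differentiable and
`div W(x) = 0`, `div U(x) = 0`:
`curl (W × A)(x) = DW[U x] + ½DW[x] − αDW[e × x] + W − DU[W] + α e × W` (tree `curl_cross_apply`). [folklore] -/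
theorem curl_cross_transportField {W U : EuclideanSpace ℝ (Fin 3) → EuclideanSpace ℝ (Fin 3)} {x : EuclideanSpace ℝ (Fin 3)}
    (hW : DifferentiableAt ℝ W x) (hU : DifferentiableAt ℝ U x) (hdivW : VectorCalculus.divergence W x = 0)
    (hdivU : VectorCalculus.divergence U x = 0) (α : ℝ) (e : EuclideanSpace ℝ (Fin 3)) :
    curl (fun y => cross (W y) (U y + (1 / 2 : ℝ) • y - α • cross e y)) x
      = fderiv ℝ W x (U x) + (1 / 2 : ℝ) • fderiv ℝ W x x - α • fderiv ℝ W x (cross e x) + W x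
        - fderiv ℝ U x (W x) + α • cross e (W x) := by
  have hA := hasFDerivAt_transportField hU α e
  rw [curl_cross_apply hW hA.differentiableAt, hA.fderiv, divergence_transportField hU α e, hdivW, hdivU]
  simp only [zero_smul, sub_zero, zero_add, map_add, map_sub, map_smul, _root_.add_apply, _root_.sub_apply,
    _root_.smul_apply, ContinuousLinearMap.id_apply, crossCLM_apply]
  module

/-- **F6 memo §1(a) as printed: `curl E_α(U) = −ΔW + curl(W × A)`**, `W = curl U`, `A = U + ½y − α e₃×y`, for
`U ∈ C³(ℝ³; ℝ³)` divergence-free (`div W = 0` is `div curl = 0`). [folklore] -/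
theorem curl_profileOp_eq_transport (α : ℝ) {U : EuclideanSpace ℝ (Fin 3) → EuclideanSpace ℝ (Fin 3)}
    (hU : ContDiff ℝ 3 U) (hdiv : VectorCalculus.IsDivFree U) (x : EuclideanSpace ℝ (Fin 3)) :
    curl (fun y => α • (cross (EuclideanSpace.single 2 1) (U y) - fderiv ℝ U y (cross (EuclideanSpace.single 2 1) y))
        + (1 / 2 : ℝ) • U y + (1 / 2 : ℝ) • fderiv ℝ U y y - (Δ U) y + fderiv ℝ U y (U y)) x
      = -(Δ (curl U)) x
        + curl (fun y => cross (curl U y) (U y + (1 / 2 : ℝ) • y - α • cross (EuclideanSpace.single 2 1) y)) x := by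
  have hU2 : ContDiff ℝ 2 U := hU.of_le (by norm_num)
  have hUx : DifferentiableAt ℝ U x := (hU.differentiable (by norm_num)) x
  have hW : DifferentiableAt ℝ (curl U) x :=
    ((contDiff_curl (n := 1) (by exact hU2)).differentiable one_ne_zero) x
  have hdivW : VectorCalculus.divergence (curl U) x = 0 := divergence_curl_eq_zero_holds U hU2 x
  rw [curl_profileOp α hU hdiv x, curl_cross_transportField hW hUx hdivW (hdiv x) α]
  simp only [smul_sub]
  abel

end TorqueBudget

end Summit.NavierStokesRegularity.NavierStokesRegularity.Theorems
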